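import Mathlib
import HarnessLib
import Summits.Langlands.Langlands.Theorems.TwistUnpackaging.Negative.ControlLoadBearing

/-!
# `TwistUnpackaging` (stmt-Langlands-10903) — negative knowledge III: the polarized shadow

The full crux keeps the polarization hypothesis `hpol` (`Sat(π, τw) = Sat(π, w)⁻¹ · κ_v`), so in
the Frobenius-data shadow both truth and claim have second halves `X' = κ•X⁻¹`, `P' = κ•P⁻¹`
(normalise `κ = 1`). Control stays load-bearing: `extractionWithoutControlPolarized_false` — the
TRANSPOSITION adversary (claim at `w` the truth of `τw` and vice versa, on the diagonal set of
`diagonal_adversary`) is polarization-compatible and invisible to `ψ = 1`. From the standing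
disprover's `Disproof.lean` (cdisprove cycle 2). Mathlib-only combinatorics. [folklore]
-/

namespace Summit.Langlands.Langlands.Theorems.TwistUnpackaging.Negative

open Multiset

/-- **Polarized shadow** (the full crux keeps `hpol`: `Sat(π, τw) = Sat(π, w)⁻¹ · κ_v`, so truth AND
claim satisfy `X' = κ•X⁻¹`, `P' = κ•P⁻¹`; normalise `κ = 1`). Same statement as
`ExtractionWithoutControl` with the second halves hard-wired as pointwise inverses. Still FALSE:
`extractionWithoutControlPolarized_false` — the TRANSPOSITION adversary (claim at `w` the truth
of `τw` and vice versa) is polarization-compatible and invisible to `ψ = 1`. [folklore] -/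
def ExtractionWithoutControlPolarized (n : ℕ) : Prop :=
  ∀ (X P : ℕ → Multiset ℂ) (t : ℕ → ℕ → ℂ),
    (∀ v, card (X v) = n ∧ card (P v) = n) →
    (∀ v, t 0 v = 1) →
    (∀ k N : ℕ, ∃ v, N ≤ v ∧ ∀ i ≤ k, t i v = 1) →
    (∀ v, ∃ i, orderOf (t i v) = 0 ∨ n < orderOf (t i v)) →
    (∀ i, ∀ᶠ v in Filter.cofinite,
      X v + ((X v).map (·⁻¹)).map (t i v * ·) = P v + ((P v).map (·⁻¹)).map (t i v * ·)) →
    ∀ᶠ v in Filter.cofinite, P v = X v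

/-- `{2, 3} ≠ {2⁻¹, 3⁻¹}`: the transposition adversary really changes the data. [folklore] -/
lemma pair_ne_inv : ({2⁻¹, 3⁻¹} : Multiset ℂ) ≠ {2, 3} := by
  intro h
  have : (2 : ℂ) ∈ ({2⁻¹, 3⁻¹} : Multiset ℂ) := by rw [h]; simp
  simp only [Multiset.insert_eq_cons, Multiset.mem_cons, Multiset.mem_singleton] at this
  rcases this with h' | h'
  · have := congrArg (· * 2) h'; norm_num at this
  · have := congrArg (· * 3) h'; norm_num at this

/-- **`TwistUnpackaging` is FALSE WITHOUT CONTROL even for polarized data (rank 2).** Truth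
`X = {2, 3}`, `X' = X⁻¹`; on the diagonal set `E` claim `P = X⁻¹` (hence `P' = P⁻¹ = X`): every
twisted identity holds off finitely many places of `E`, the claim is wrong on all of `E`.
[folklore] -/
theorem extractionWithoutControlPolarized_false : ¬ ExtractionWithoutControlPolarized 2 := by
  intro h
  classical
  have hswap : ∀ v : ℕ, ((fun _ => ({2, 3} : Multiset ℂ)) v) + (fun _ => ({2⁻¹, 3⁻¹} : Multiset ℂ)) v
      = (fun _ => ({2⁻¹, 3⁻¹} : Multiset ℂ)) v + (fun _ => ({2, 3} : Multiset ℂ)) v :=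
    fun _ => add_comm _ _
  obtain ⟨E, hE, hfin⟩ := diagonal_adversary (fun _ => {2, 3}) (fun _ => {2⁻¹, 3⁻¹})
    (fun _ => {2⁻¹, 3⁻¹}) (fun _ => {2, 3}) hswap tEx tEx_rich
  let P : ℕ → Multiset ℂ := fun v => if v ∈ E then {2⁻¹, 3⁻¹} else {2, 3}
  have hXinv : ((({2, 3} : Multiset ℂ)).map (·⁻¹)) = {2⁻¹, 3⁻¹} := by simp
  have hPinv : ∀ v, (P v).map (·⁻¹) = if v ∈ E then ({2, 3} : Multiset ℂ) else {2⁻¹, 3⁻¹} := by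
    intro v; simp only [P]; split_ifs <;> simp
  have hcard : ∀ v : ℕ, card ((fun _ => ({2, 3} : Multiset ℂ)) v) = 2 ∧ card (P v) = 2 := by
    intro v
    refine ⟨by simp, ?_⟩
    simp only [P]; split_ifs <;> simp
  have hfam : ∀ i, ∀ᶠ v in Filter.cofinite, (fun _ => ({2, 3} : Multiset ℂ)) v +
      (((fun _ => ({2, 3} : Multiset ℂ)) v).map (·⁻¹)).map (tEx i v * ·) =
      P v + ((P v).map (·⁻¹)).map (tEx i v * ·) := by
    intro i
    rw [Filter.eventually_cofinite]
    refine (hfin i).subset fun v hv => ?_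
    simp only [Set.mem_setOf_eq] at hv ⊢
    rw [hXinv, hPinv] at hv
    by_cases hvE : v ∈ E
    · exact ⟨hvE, by simpa [P, hvE] using hv⟩
    · exact absurd (by simp [P, hvE]) hv
  have key := h (fun _ => {2, 3}) P tEx hcard (fun _ => rfl) tEx_rich tEx_separating hfam
  rw [Filter.eventually_cofinite] at key
  refine hE (key.subset fun v hv => ?_)
  simp only [Set.mem_setOf_eq, P, if_pos hv]
  exact pair_ne_inv


end Summit.Langlands.Langlands.Theorems.TwistUnpackaging.Negative
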